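import Summits.CriticalPhenomena.PercolationContinuityZ3.Theorems.PercNearOneGluingNoHeavyQuantSliceDomination
import Summits.CriticalPhenomena.PercolationContinuityZ3.Theorems.PercNearOneGluingNoHeavyQuantSliceConeForm
import Summits.CriticalPhenomena.PercolationContinuityZ3.Theorems.PercNearOneGluingNoHeavyQuantSliceTwoRowRates
import Summits.CriticalPhenomena.PercolationContinuityZ3.Theorems.PercNearOneGluingNoHeavyQuantLawDecUsageMonge
import HarnessLib

/-!
# QUANT lane R8, T-DEC: SINGLE-LAYER DOMINATION OF SLICE CERTIFICATES — the hypothesis-free, tilt-free sharpening of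
# `LawDec.SliceDominated` (census-2 g55), its absorber half PROVED, and the kernel reductions
# `SliceSingleLayer → SliceDominated`, `→ SliceClosedAll`, `→ SliceClosedWindowT`

builds on p205010 (kernel theorem, internal audit signed; external expert review pending)

Statement + support file (`--supports stmt-CriticalPhenomena-4575`), QUANT lane seat prim-quant-census-2 (gen 55), rung R8 of
`run/shared/lean/prim/quant/LADDER.md`.  Memo `run/shared/lean/prim/quant/prim-quant-census-2-g55/SINGLE-LAYER-G55.md`.  One small
definition (`LawDec.slicePullback`), one `@[conjecture]`, theorems with standard axioms, no sorries.

THE FINDING (census-2 g55; exact rational arithmetic, new engine `code/dd.py` + `code/lamcheck.py`: exact double description of the DEC cones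
and their duals, two independent membership tests).  Let `(α, β)` be ANY price system of the slice positions `{0..M+a}` at target `T′ = T + a·g`,
layer `j′` (`β ≥ 0` on absorbers, `α_p ≤ usage·β_q` on compatible pairs) and let `Φ(k) = (1−g)·e(k) + g·e(k+a)` (`e = coefAt T′ j′ α β`) be its
pullback to the atoms `k ≤ M` — the functional with `⟨Φ, μ⟩ = ⟨e, slice μ a g⟩` (`slice_functional_eq`).  Then, in every instance tested, there is
ONE layer `J ∈ [j′−a, j′]` at which `Φ` ITSELF is a price system of target `T`: `Φ ≤ 0` on the `J`-absorbers and `Φ(l) ≤ usage_J(l,h)·(−Φ(h))` on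
the `J`-compatible pairs.  No hypothesis on any law, no mean tilt `λ`, explicit target (cone form).  EVIDENCE (0 failures): per extreme ray of the
slice's dual cone on ≈ 4·10⁵ supports (random, aimed multi-low, full supports `{0..M}`; kit j142357 at scale); 92 000 random TIGHT (non-extreme)
certificates; 27 000 sums of 2–3 extreme rays; 36 000 adversarial hill-climbs on the prices (the same climber breaks any FIXED layer in 28–74 %
of supports and the fixed pair `{λ*, j′}` taken one-layer-at-a-time in 0.6 %); `g = 1` included.  By contrast a genuine two-layer SPLIT between the
fixed layers `j′` and `λ* = (least true window mid) − 1` is needed for ≈ 0.5 % of extreme rays (all of them single-layer dominated by an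
intermediate layer), and SL-λ* itself (`D(T,j′) ∩ D(T,λ*) ⊆ slice⁻¹ D(T′,j′)`) has 0 failures on ≈ 1.2·10⁵ aimed multi-low supports (two-layer
`{j′−a, j′}` control: 8.1 % failures, = the refuted `SliceClosed`).

WHY THIS IS THE STATEMENT TO PROVE.  (i) It implies everything the lane uses: `SliceDominated` (take `λ = 0` and the layer-`J` system `:= Φ`),
hence `SliceClosedAll` (`sliceClosedAll_of_dominated`, census-2 g54) and BLOB-DEC(k) ∀ k; and the window form `SliceClosedWindowT` of record
(lead g22, p301931) directly by weak duality at `J` + strong duality for the slice.  (ii) It is LOCAL: the absorber conditions hold at EVERY window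
layer (`slicePullback_nonpos_of_absorber`, proved here: both copies of a mid are slice absorbers, and a band / window-low atom is self-financing
through its own row-1 copy because `x ≤ g` — `band_vertical_selfFinancing`, `gate_div_le`), window lows are harmless (`slicePullback_windowLow`),
so the content is the LOW conditions for the lows `l ≤ j′−a`, and for those the memo gives the choice `J(Φ) := max(j′−a, h_c)`, `h_c` = the
largest CHEAP window atom (`−Φ(h) < max_l Φ(l)·(1−x)/x`), under which single-layer domination is equivalent to two finite families of
inequalities between usage rates (LEMMA D: absorbers `≤ j′−a`; LEMMA W′: window atoms below a cheap one) — each verified exactly on its own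
(deep case: four breakpoints of a concave piecewise-linear function of two prices, 1.9·10⁶ grid cells, worst slack −5·10⁻⁵; shallow case: worst
slack 0, attained at `g = x`).  Those two lemmas are the remaining paper/kernel work; this file fixes the statement and the reductions.

* `LawDec.slicePullback T′ g j′ a α β k = (1−g)·coefAt T′ j′ α β k + g·coefAt T′ j′ α β (k+a)`.
* **`LawDec.SliceSingleLayer`** (`@[conjecture]`) — the single-layer domination property above (`0 < x < 1`, `x ≤ g ≤ 1`, `1 ≤ a`, `j′ < M + a`).
* **`LawDec.slicePullback_nonpos_of_absorber`** (THEOREM) — for every atom `h ≤ M` with `T ≤ 2h` or `j′ < h + a` (i.e. every absorber of every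
  window layer), `slicePullback … h ≤ 0`; `slicePullback_windowLow` — the same bound for window lows.
* **`LawDec.sliceDominated_of_singleLayer : SliceSingleLayer → SliceDominated`**, **`sliceClosedAll_of_singleLayer`**,
  **`sliceClosedWindowT_of_singleLayer : SliceSingleLayer → SliceClosedWindowT`**.
HONEST: `SliceSingleLayer`, `SliceDominated`, `SliceClosedAll`, `SliceClosedWindowT`, `ConvClosedT`, BLOB-DEC(k ≥ 3), `TreeBuiltDEC`, `SDECConvClosed`,
`Quant.TreeDEC`, `FarTreeRow` remain OPEN; `SliceClosed`/`SliceClosedT` are FALSE.  RATE / honest sentence unchanged.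

[this work]; memos SL-STRUCTURE-G54, LEAD-NOTES-G22 N47–N48, SINGLE-LAYER-G55 (this lane).  Farkas [cite: Schrijver1986, Cor 7.1f (p. 90)].  The gluing
rows served [cite: KozmaNitzan2024, Conjecture 3 (p. 15)]; product measure [cite: Grimmett1999, §1.3 p. 10].
-/

noncomputable section

namespace Summit.CriticalPhenomena.PercolationContinuityZ3.Theorems

namespace Quant

open Finset

namespace LawDec

/-! ### The pullback of a slice price functional -/

/-- **pullback of a price functional of the slice positions to the atoms**: `Φ(k) = (1−g)·e(k) + g·e(k+a)` with `e = coefAt T′ j′ α β`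
(`α` on the slice's lows, `−β` elsewhere); `Σ_k Φ(k)·μ k = Σ_p e(p)·slice μ a g p` (`slice_functional_eq`). [this work] -/
def slicePullback (T' g : ℝ) (j' a : ℕ) (α β : ℕ → ℝ) (k : ℕ) : ℝ :=
  (1 - g) * coefAt T' j' α β k + g * coefAt T' j' α β (k + a)

/-! ### The conjecture -/

/-- **CONJECTURE (single-layer domination of slice certificates; census-2 g55).**  For a floor `0 < x < 1`, a gate `x ≤ g ≤ 1`, a blob size
`a ≥ 1`, a layer `j′ < M + a`, ANY real target `T` and ANY price system `(α, β)` of the slice positions at target `T + a·g`, layer `j′`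
(`β ≥ 0`; `α l ≤ usage·β h` for `l ≤ j′`, `2l < T + ag`, `h ≤ M + a` compatible), there is a layer `J` with `j′ − a ≤ J ≤ j′`, `J ≤ M`, at which the
pullback `Φ = slicePullback (T + ag) g j′ a α β` is itself a price system of target `T` on `{0..M}`: `Φ h ≤ 0` for every `h ≤ M` that is not a
`J`-low, and `Φ l ≤ usage x T J l h · (−Φ h)` for every `J`-low `l` (`l ≤ J`, `2l < T`) and every compatible `h ≤ M` (`h ≥ J+1` or `T < l + h`).
No hypothesis on any law; no mean tilt.  Implies `SliceDominated`, `SliceClosedAll`, `SliceClosedWindowT` (below).  EVIDENCE: file header.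
[this work] [status: open] -/
@[conjecture] def SliceSingleLayer : Prop :=
  ∀ (x g T : ℝ) (M a j' : ℕ) (α β : ℕ → ℝ),
    0 < x → x < 1 → x ≤ g → g ≤ 1 → 1 ≤ a → j' < M + a →
    (∀ h, 0 ≤ β h) →
    (∀ l h, l ≤ j' → 2 * (l : ℝ) < T + (a : ℝ) * g → h ≤ M + a →
      (j' + 1 ≤ h ∨ T + (a : ℝ) * g < (l : ℝ) + h) → α l ≤ usage x (T + (a : ℝ) * g) j' l h * β h) →
    ∃ J : ℕ, j' ≤ J + a ∧ J ≤ j' ∧ J ≤ M ∧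
      (∀ h, h ≤ M → ¬ (h ≤ J ∧ 2 * (h : ℝ) < T) → slicePullback (T + (a : ℝ) * g) g j' a α β h ≤ 0) ∧
      (∀ l h, l ≤ J → 2 * (l : ℝ) < T → h ≤ M → (J + 1 ≤ h ∨ T < (l : ℝ) + h) →
        slicePullback (T + (a : ℝ) * g) g j' a α β l
          ≤ usage x T J l h * (- slicePullback (T + (a : ℝ) * g) g j' a α β h))

/-! ### The absorber half (proved): at every window layer the pullback is `≤ 0` off the lows -/

/-- **THE ABSORBER CONDITIONS HOLD AT EVERY WINDOW LAYER.**  For a slice price system as in `SliceSingleLayer` (`0 < x < 1`, `x ≤ g ≤ 1`,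
`1 ≤ a`) and an atom `h ≤ M` with `T ≤ 2h` (a mid of target `T`) or `j′ < h + a` (its row-1 copy is a slice giant — every atom above `j′ − a`),
`slicePullback (T+ag) g j′ a α β h ≤ 0`.  Cases: the row-1 copy `h + a` is never a slice low (`2(h+a) ≥ T + 2a ≥ T + ag`, resp. `h + a > j′`); if
the row-0 copy is a slice absorber both terms are `≤ 0`; otherwise it is a slice low priced at most `usage(h, h+a)·β(h+a)` through the VERTICAL
pair, and `(1−g)·usage(h,h+a) ≤ g` — for a giant copy because `usage = x/(1−x)` and `x ≤ g`, for a mid copy by `pairGate_vertical_le`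
(`ρ_v = (T + ag − 2h)/a ≤ g`).  Hence the `J`-absorbers of every `J ≥ j′ − a` satisfy the first conjunct of `SliceSingleLayer`. [this work] -/
theorem slicePullback_nonpos_of_absorber (x g T : ℝ) (M a j' : ℕ) (α β : ℕ → ℝ)
    (hx0 : 0 < x) (hx1 : x < 1) (hxg : x ≤ g) (hg1 : g ≤ 1) (ha : 1 ≤ a)
    (hβ : ∀ h, 0 ≤ β h)
    (hαβ : ∀ l h, l ≤ j' → 2 * (l : ℝ) < T + (a : ℝ) * g → h ≤ M + a →
      (j' + 1 ≤ h ∨ T + (a : ℝ) * g < (l : ℝ) + h) → α l ≤ usage x (T + (a : ℝ) * g) j' l h * β h)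
    (h : ℕ) (hhM : h ≤ M) (habs : T ≤ 2 * (h : ℝ) ∨ j' < h + a) :
    slicePullback (T + (a : ℝ) * g) g j' a α β h ≤ 0 := by
  have hg0 : 0 ≤ g := hx0.le.trans hxg
  have ha0 : (0 : ℝ) ≤ a := Nat.cast_nonneg a
  have hag : (a : ℝ) * g ≤ a := by nlinarith
  -- the row-1 copy `h + a` is not a slice low
  have hrow1 : ¬ (h + a ≤ j' ∧ 2 * ((h + a : ℕ) : ℝ) < T + (a : ℝ) * g) := by
    rintro ⟨h1, h2⟩
    rcases habs with hT | hj
    · push_cast at h2; linarith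
    · omega
  unfold slicePullback
  have e2 : coefAt (T + (a : ℝ) * g) j' α β (h + a) = -β (h + a) := by
    unfold coefAt; rw [if_neg hrow1]
  rw [e2]
  by_cases hlow : h ≤ j' ∧ 2 * (h : ℝ) < T + (a : ℝ) * g
  · -- the row-0 copy is a slice low: vertical pair
    have e1 : coefAt (T + (a : ℝ) * g) j' α β h = α h := by unfold coefAt; rw [if_pos hlow]
    rw [e1]
    rcases hg1.lt_or_eq with hg1' | hg1'
    · -- g < 1
      by_cases hgi : j' + 1 ≤ h + a
      · -- the row-1 copy is a giant: usage x/(1−x)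
        have hb := hαβ h (h + a) hlow.1 hlow.2 (by omega) (Or.inl hgi)
        rw [usage_giant_eq x _ j' h (h + a) hgi] at hb
        have hsf : (1 - g) * (x / (1 - x)) ≤ g := gate_div_le x g hxg hg1'
        have h1g : 0 ≤ 1 - g := by linarith
        have := mul_le_mul_of_nonneg_left hb h1g
        nlinarith [hβ (h + a), this, hsf]
      · -- the row-1 copy is a mid: band atom, vertical pair at gate ≤ g
        have hT : T ≤ 2 * (h : ℝ) := by
          rcases habs with hT | hj
          · exact hT
          · exfalso; omega
        have hcomp : T + (a : ℝ) * g < (h : ℝ) + ((h + a : ℕ) : ℝ) := by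
          push_cast
          have : (a : ℝ) * g < a := by
            have ha1 : (1 : ℝ) ≤ a := by exact_mod_cast ha
            nlinarith
          linarith
        have hb := hαβ h (h + a) hlow.1 hlow.2 (by omega) (Or.inr hcomp)
        have hgate : pairGate x (T + (a : ℝ) * g) h (h + a) ≤ g := pairGate_vertical_le x T g h a hx0.le hxg hg1 ha hT
        have hu : usage x (T + (a : ℝ) * g) j' h (h + a)
            = pairGate x (T + (a : ℝ) * g) h (h + a) / (1 - pairGate x (T + (a : ℝ) * g) h (h + a)) := by
          simp only [usage, gateOf, if_neg hgi]
        rw [hu] at hb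
        have hsf : (1 - g) * (pairGate x (T + (a : ℝ) * g) h (h + a) / (1 - pairGate x (T + (a : ℝ) * g) h (h + a))) ≤ g :=
          gate_div_le _ g hgate hg1'
        have h1g : 0 ≤ 1 - g := by linarith
        have := mul_le_mul_of_nonneg_left hb h1g
        nlinarith [hβ (h + a), this, hsf]
    · -- g = 1: the row-0 term vanishes
      rw [hg1']
      have := hβ (h + a)
      linarith
  · -- the row-0 copy is a slice absorber
    have e1 : coefAt (T + (a : ℝ) * g) j' α β h = -β h := by unfold coefAt; rw [if_neg hlow]
    rw [e1]
    have h1 := hβ h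
    have h2 := hβ (h + a)
    have h1g : 0 ≤ 1 - g := by linarith
    nlinarith

/-- **window lows are harmless**: an atom `l ≤ M` with `2l < T` above `j′ − a` (a low of every window layer `J ≥ l`) has
`slicePullback … l ≤ 0` (its row-1 copy is a slice giant; self-financing as above) — so its low conditions `Φ l ≤ usage·(−Φ h)` hold as soon as
`−Φ h ≥ 0` and `usage ≥ 0`. [this work] -/
theorem slicePullback_windowLow (x g T : ℝ) (M a j' : ℕ) (α β : ℕ → ℝ)
    (hx0 : 0 < x) (hx1 : x < 1) (hxg : x ≤ g) (hg1 : g ≤ 1) (ha : 1 ≤ a)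
    (hβ : ∀ h, 0 ≤ β h)
    (hαβ : ∀ l h, l ≤ j' → 2 * (l : ℝ) < T + (a : ℝ) * g → h ≤ M + a →
      (j' + 1 ≤ h ∨ T + (a : ℝ) * g < (l : ℝ) + h) → α l ≤ usage x (T + (a : ℝ) * g) j' l h * β h)
    (l : ℕ) (hlM : l ≤ M) (hwin : j' < l + a) :
    slicePullback (T + (a : ℝ) * g) g j' a α β l ≤ 0 :=
  slicePullback_nonpos_of_absorber x g T M a j' α β hx0 hx1 hxg hg1 ha hβ hαβ l hlM (Or.inr hwin)

/-! ### Reductions: single-layer domination ⟹ `SliceDominated`, `SliceClosedAll`, `SliceClosedWindowT` -/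

/-- the layer-`J` price system read off the pullback: if `β′ h = −Φ h` on the `J`-absorbers `h ≤ M`, then `coefAt T J Φ β′ = Φ` on `{0..M}`.
[this work] -/
theorem coefAt_pullback_eq (T : ℝ) (J M : ℕ) (Φ β' : ℕ → ℝ)
    (hβ' : ∀ k, k ≤ M → ¬ (k ≤ J ∧ 2 * (k : ℝ) < T) → β' k = -Φ k) (k : ℕ) (hk : k ≤ M) :
    coefAt T J Φ β' k = Φ k := by
  unfold coefAt
  by_cases hl : k ≤ J ∧ 2 * (k : ℝ) < T
  · rw [if_pos hl]
  · rw [if_neg hl, hβ' k hk hl, neg_neg]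

/-- **`SliceSingleLayer → SliceDominated`** (take the layer `J`, the price system `Φ` itself, and tilt `λ = 0`). [this work] -/
theorem sliceDominated_of_singleLayer (hS : SliceSingleLayer) : SliceDominated := by
  intro x g M a j' μ hx0 hxg hg1 ha hμ0 hμM hμ1 htop hjM hdec α β hβ hαβ
  have hx1 : x < 1 := lt_of_le_of_lt hxg hg1
  set T : ℝ := ∑ k ∈ Finset.range (M + 1), (k : ℝ) * μ k with hT
  obtain ⟨J, hJ1, hJ2, hJM, habs, hlows⟩ := hS x g T M a j' α β hx0 hx1 hxg hg1.le ha hjM hβ hαβ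
  set Φ : ℕ → ℝ := slicePullback (T + (a : ℝ) * g) g j' a α β with hΦ
  set β' : ℕ → ℝ := fun h => if h ≤ M ∧ ¬ (h ≤ J ∧ 2 * (h : ℝ) < T) then -Φ h else 0 with hβ'
  have hβ'eq : ∀ k, k ≤ M → ¬ (k ≤ J ∧ 2 * (k : ℝ) < T) → β' k = -Φ k := by
    intro k hk hnl
    have hc : k ≤ M ∧ ¬ (k ≤ J ∧ 2 * (k : ℝ) < T) := And.intro hk hnl
    simp only [hβ', if_pos hc]
  have hβ'0 : ∀ h, 0 ≤ β' h := by
    intro h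
    by_cases hc : h ≤ M ∧ ¬ (h ≤ J ∧ 2 * (h : ℝ) < T)
    · rw [hβ'eq h hc.1 hc.2]; linarith [habs h hc.1 hc.2]
    · simp only [hβ', if_neg hc]; exact le_rfl
  refine ⟨J, Φ, β', 0, by omega, hJ2, hJM, hβ'0, ?_, ?_⟩
  · intro l h hlJ hlow hhM hcomp
    have hnl : ¬ (h ≤ J ∧ 2 * (h : ℝ) < T) := by
      rintro ⟨h1, h2⟩
      rcases hcomp with hc | hc
      · omega
      · linarith
    rw [hβ'eq h hhM hnl]
    exact hlows l h hlJ hlow hhM hcomp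
  · intro k hk
    rw [coefAt_pullback_eq T J M Φ β' hβ'eq k hk, zero_mul, add_zero]
    have e : (1 - g) * coefAt (T + (a : ℝ) * g) j' α β k + g * coefAt (T + (a : ℝ) * g) j' α β (k + a) = Φ k := by
      simp only [hΦ, slicePullback]
    rw [e]

/-- **`SliceSingleLayer → SliceClosedAll`** (via `sliceClosedAll_of_dominated`). [this work] -/
theorem sliceClosedAll_of_singleLayer (hS : SliceSingleLayer) : SliceClosedAll :=
  sliceClosedAll_of_dominated (sliceDominated_of_singleLayer hS)

/-- **`SliceSingleLayer → SliceClosedWindowT`** (the window form of record, cone version): for a probability law `μ` on `{0..M}` that is DEC at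
target `T` at every window layer, and a slice price system `(α, β)`: weak duality at the dominating layer `J` (`dual_le_of_decAtT` with the
system `Φ`), rewritten through `dual_functional_eq` / `slice_functional_eq`, is the weak-duality inequality of the slice; strong duality
(`decAtT_iff_prices`) concludes. [this work] -/
theorem sliceClosedWindowT_of_singleLayer (hS : SliceSingleLayer) : SliceClosedWindowT := by
  intro x g T M a j' μ hx0 hx1 hxg hg1 ha hμ0 hμM hμ1 hjM hwin
  -- law facts of the slice
  have hsM : ∀ h, M + a < h → slice μ a g h = 0 := fun h hh => slice_eq_zero μ a g M hμM h hh
  have hs1 := sum_slice μ a g M hμM hμ1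
  rw [decAtT_iff_prices x (T + (a : ℝ) * g) j' (M + a) (slice μ a g) hx0 hx1 hsM hs1]
  intro α β hβ hαβ
  obtain ⟨J, hJ1, hJ2, hJM, habs, hlows⟩ := hS x g T M a j' α β hx0 hx1 hxg hg1 ha hjM hβ hαβ
  set Φ : ℕ → ℝ := slicePullback (T + (a : ℝ) * g) g j' a α β with hΦ
  set β' : ℕ → ℝ := fun h => if h ≤ M ∧ ¬ (h ≤ J ∧ 2 * (h : ℝ) < T) then -Φ h else 0 with hβ'
  have hβ'eq : ∀ k, k ≤ M → ¬ (k ≤ J ∧ 2 * (k : ℝ) < T) → β' k = -Φ k := by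
    intro k hk hnl
    have hc : k ≤ M ∧ ¬ (k ≤ J ∧ 2 * (k : ℝ) < T) := And.intro hk hnl
    simp only [hβ', if_pos hc]
  have hβ'0 : ∀ h, 0 ≤ β' h := by
    intro h
    by_cases hc : h ≤ M ∧ ¬ (h ≤ J ∧ 2 * (h : ℝ) < T)
    · rw [hβ'eq h hc.1 hc.2]; linarith [habs h hc.1 hc.2]
    · simp only [hβ', if_neg hc]; exact le_rfl
  have hαβ' : ∀ l h, l ≤ J → 2 * (l : ℝ) < T → h ≤ M → (J + 1 ≤ h ∨ T < (l : ℝ) + h) → Φ l ≤ usage x T J l h * β' h := by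
    intro l h hlJ hlow hhM hcomp
    have hnl : ¬ (h ≤ J ∧ 2 * (h : ℝ) < T) := by
      rintro ⟨h1, h2⟩
      rcases hcomp with hc | hc
      · omega
      · linarith
    rw [hβ'eq h hhM hnl]
    exact hlows l h hlJ hlow hhM hcomp
  -- weak duality at layer J
  have hdecJ : DECAtT x T J M μ := hwin J hJ2 hJ1
  have wd := dual_le_of_decAtT x T J M μ hx0 hx1 hdecJ Φ β' hβ'0 hαβ'
  have wd_eq := dual_functional_eq T J M Φ β' μ hJM
  have hcoef : ∀ k ∈ Finset.range (M + 1), coefAt T J Φ β' k * μ k = Φ k * μ k := by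
    intro k hk
    rw [coefAt_pullback_eq T J M Φ β' hβ'eq k (Nat.lt_succ_iff.1 (Finset.mem_range.1 hk))]
  rw [Finset.sum_congr rfl hcoef] at wd_eq
  -- the slice functional equals Σ Φ μ
  have goal_eq := dual_functional_eq (T + (a : ℝ) * g) j' (M + a) α β (slice μ a g) hjM.le
  rw [slice_functional_eq μ (coefAt (T + (a : ℝ) * g) j' α β) M a g hμM] at goal_eq
  have hsame : ∑ k ∈ Finset.range (M + 1),
      ((1 - g) * coefAt (T + (a : ℝ) * g) j' α β k + g * coefAt (T + (a : ℝ) * g) j' α β (k + a)) * μ k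
      = ∑ k ∈ Finset.range (M + 1), Φ k * μ k := by
    refine Finset.sum_congr rfl fun k _ => ?_
    simp only [hΦ, slicePullback]
  rw [hsame, ← wd_eq] at goal_eq
  linarith [goal_eq, wd]

end LawDec

end Quant

end Summit.CriticalPhenomena.PercolationContinuityZ3.Theorems
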